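import Mathlib
import Summits.ValiantsHypothesis.ValiantsHypothesis.Theorems.BarrierLeverDefinableEquationsProductDepthWallTwoMerge

/-!
# Route BarrierLever — crux `DefinableEquations` (stmt-8745) / item `SingleSizeEquations`
# (stmt-8749): FREE BLOCKS PEEL OFF the word polynomial; merge prefix + free tail ⇒ linear size
# (val-np-p5 g15, part 3 of `…ProductDepthWallTwo*`)

* §5 If the LAST block of a word lies on the longer-or-equal side (its label is never compared
  with anything) or has no bits, then `P_w = P_{w'} · (∑_x X⟨last, x⟩)` with `w'` the word without
  its last block (`wordPoly_eq_mul_of_free`; the split of the assignments is `Fin.snocEquiv`, the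
  compatibility calculus is the tree's `compat_append_iff_of_le`); so peeling it costs
  `≤ 2^{|w_last|} + 1` gates (`complexity_wordPoly_le_of_free`).
* §6 Induction on the tail: a word whose blocks `t < d'` are in merge position with letters `≥ 1`
  and whose blocks `t ≥ d'` are free at their time has `L(P_w) ≤ 6 · ∑_t 2^{|w_t|}`
  (`complexity_wordPoly_le_of_mergePrefix`, from part 2's `complexity_wordPoly_le_of_merge`).

What this is NOT: nothing on the crux (b = 2 OPEN, Chatterjee–Tengse §1.3 dir. 2) or `VP ≠ VNP`;
no definitions, no named facts, standard axioms.
Refs: Limaye–Srinivasan–Tavenas, J. ACM 72 (2025) Art. 26, §2.2 and Lemma 22; Bürgisser 2000, §2.1.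
-/

-- `Summit.ValiantsHypothesis.ValiantsHypothesis.…` repeats a component (D-0017 layout); mandated.
set_option linter.dupNamespace false

noncomputable section

namespace Summit.ValiantsHypothesis.ValiantsHypothesis.Theorems.BarrierLeverDefinableEquations

open MvPolynomial
open Literature.Computability.AlgebraicComplexity
open Literature.Computability.AlgebraicComplexity.LSTWord
open scoped BigOperators

namespace ProductDepthWallTwo

/-! ## §5 Free blocks at the end of a word: peeling -/

section Peel

variable {m : ℕ} (k : ℕ) (w : Fin (m + 1) → Bool) (K : Type*) [CommSemiring K]

/-- Stream lengths of the truncated word `w ∘ castSucc` are those of `w` up to layer `m`.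
[cite: LimayeSrinivasanTavenas2025, §2.2] -/
theorem streamLen_castSucc (sgn : Bool) (t : ℕ) (ht : t ≤ m) :
    streamLen k (fun i : Fin m => w (Fin.castSucc i)) sgn t = streamLen k w sgn t := by
  induction t with
  | zero => rfl
  | succ t ih =>
    have ht' : t < m := Nat.lt_of_succ_le ht
    rw [streamLen_succ k _ sgn ht', streamLen_succ k w sgn (Nat.lt_succ_of_lt ht'), ih ht'.le]
    rfl

/-- Streams of the truncated word and truncated assignment are those of `w` up to layer `m`.
[cite: LimayeSrinivasanTavenas2025, §2.2] -/
theorem stream_castSucc (sgn : Bool) (W : (i : Fin (m + 1)) → BlockVar k w i) (t : ℕ) (ht : t ≤ m) :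
    stream k (fun i : Fin m => w (Fin.castSucc i)) sgn (fun i => W (Fin.castSucc i)) t =
      stream k w sgn W t := by
  induction t with
  | zero => rfl
  | succ t ih =>
    have ht' : t < m := Nat.lt_of_succ_le ht
    rw [stream_succ k _ sgn _ ht', stream_succ k w sgn W (Nat.lt_succ_of_lt ht'), ih ht'.le]
    rfl

/-- The reindexing of the block variables of the truncated word. [folklore] -/
theorem castSuccVar_injective :
    Function.Injective (fun v : (Σ i : Fin m, BlockVar k (fun i : Fin m => w (Fin.castSucc i)) i) =>
      (⟨Fin.castSucc v.1, v.2⟩ : Σ i : Fin (m + 1), BlockVar k w i)) := by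
  rintro ⟨i, x⟩ ⟨j, y⟩ h
  simp only [Sigma.mk.inj_iff, Fin.castSucc_inj] at h
  obtain ⟨rfl, h2⟩ := h
  simp at h2
  subst h2; rfl

/-- **Peeling a free last block.**  If the last block of `w` lies on the LONGER-OR-EQUAL side
(so its label is never compared with anything) or has no bits, then
`P_w = P_{w'} · (∑_{x} X⟨last, x⟩)` with `w'` the word without its last block (blocks reindexed
by `castSucc`). [cite: LimayeSrinivasanTavenas2025, §2.2] -/
theorem wordPoly_eq_mul_of_free
    (hfree : streamLen k w (!w (Fin.last m)) m ≤ streamLen k w (w (Fin.last m)) m ∨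
      letterSize k w (Fin.last m) = 0) :
    wordPoly k w K =
      rename (fun v : (Σ i : Fin m, BlockVar k (fun i : Fin m => w (Fin.castSucc i)) i) =>
          (⟨Fin.castSucc v.1, v.2⟩ : Σ i : Fin (m + 1), BlockVar k w i))
        (wordPoly k (fun i : Fin m => w (Fin.castSucc i)) K) *
      ∑ x : BlockVar k w (Fin.last m), X ⟨Fin.last m, x⟩ := by
  classical
  set w' : Fin m → Bool := fun i => w (Fin.castSucc i) with hw'
  set s := w (Fin.last m) with hs
  -- compatibility of the full streams only depends on the first `m` blocks
  have hcompat : ∀ W : (i : Fin (m + 1)) → BlockVar k w i,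
      Compat (stream k w true W (m + 1)) (stream k w false W (m + 1)) ↔
        Compat (stream k w' true (fun i => W (Fin.castSucc i)) m)
          (stream k w' false (fun i => W (Fin.castSucc i)) m) := by
    intro W
    rw [stream_castSucc k w true W m le_rfl, stream_castSucc k w false W m le_rfl]
    change Valid k w W (m + 1) ↔ Valid k w W m
    rw [valid_iff k w s W (m + 1), valid_iff k w s W m,
      stream_succ k w s W (Nat.lt_succ_self m), stream_succ k w (!s) W (Nat.lt_succ_self m)]
    have hlast : (⟨m, Nat.lt_succ_self m⟩ : Fin (m + 1)) = Fin.last m := rfl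
    rw [hlast, if_pos hs.symm, if_neg (by rw [← hs]; cases s <;> decide), List.append_nil]
    rcases hfree with h | h
    · exact compat_append_iff_of_le (by rw [length_stream, length_stream]; exact h) _
    · have hnil : List.ofFn (W (Fin.last m)) = [] := by
        rw [List.ofFn_eq_nil_iff]; exact h
      rw [hnil, List.append_nil]
  unfold wordPoly
  rw [map_sum, Finset.sum_mul]
  -- split the assignments of `w` into (last label, first `m` labels)
  rw [← (Fin.snocEquiv fun i => BlockVar k w i).sum_comp, Fintype.sum_prod_type, Finset.sum_comm]
  refine Finset.sum_congr rfl fun u _ => ?_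
  rw [apply_ite (rename _), map_zero, ite_mul, zero_mul, Finset.mul_sum]
  have hsnoc : ∀ x : BlockVar k w (Fin.last m),
      (fun i : Fin m => (Fin.snocEquiv (fun i => BlockVar k w i)) (x, u) (Fin.castSucc i)) = u := by
    intro x; funext i; simp [Fin.snocEquiv]
  have hcond : ∀ x : BlockVar k w (Fin.last m),
      Compat (stream k w true ((Fin.snocEquiv fun i => BlockVar k w i) (x, u)) (m + 1))
        (stream k w false ((Fin.snocEquiv fun i => BlockVar k w i) (x, u)) (m + 1)) ↔
      Compat (stream k w' true u m) (stream k w' false u m) := by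
    intro x; rw [hcompat, hsnoc]
  simp_rw [if_congr (hcond _) rfl rfl]
  split_ifs with hc
  · refine Finset.sum_congr rfl fun x _ => ?_
    rw [Fin.prod_univ_castSucc, map_prod]
    congr 1
    · refine Finset.prod_congr rfl fun i _ => ?_
      rw [rename_X]
      simp [Fin.snocEquiv]
    · simp [Fin.snocEquiv]
  · simp

/-- Hence peeling a free last block costs at most `2^{|w_last|} + 1` gates.
[cite: Burgisser2000, §2.1] -/
theorem complexity_wordPoly_le_of_free
    (hfree : streamLen k w (!w (Fin.last m)) m ≤ streamLen k w (w (Fin.last m)) m ∨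
      letterSize k w (Fin.last m) = 0) :
    complexity (wordPoly k w K) ≤
      complexity (wordPoly k (fun i : Fin m => w (Fin.castSucc i)) K) +
        2 ^ letterSize k w (Fin.last m) + 1 := by
  classical
  rw [wordPoly_eq_mul_of_free k w K hfree]
  refine (complexity_mul_le_holds _ _).trans ?_
  have h1 := complexity_rename_le_holds' (k := K)
    (fun v : (Σ i : Fin m, BlockVar k (fun i : Fin m => w (Fin.castSucc i)) i) =>
      (⟨Fin.castSucc v.1, v.2⟩ : Σ i : Fin (m + 1), BlockVar k w i))
    (wordPoly k (fun i : Fin m => w (Fin.castSucc i)) K)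
  have h2 : complexity (∑ x : BlockVar k w (Fin.last m),
      (X ⟨Fin.last m, x⟩ : MvPolynomial (Σ i : Fin (m + 1), BlockVar k w i) K)) ≤
      2 ^ letterSize k w (Fin.last m) := by
    refine (complexity_finset_sum_le _ _).trans ?_
    rw [Finset.sum_eq_zero (fun x _ => complexity_X_holds _), zero_add, Finset.card_univ,
      card_blockVar]
  omega

end Peel

/-! ## §6 Words with a merge-ordered prefix and a free tail -/

section Tail

variable (k : ℕ) (K : Type*) [CommSemiring K]

/-- **Merge prefix + free tail ⇒ linear complexity.**  If the blocks `t < d'` of `w` are in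
merge position with letters `≥ 1`, and every block `t ≥ d'` is free at its time (on the
longer-or-equal side, or without bits), then `L(P_w) ≤ 6 · ∑_t 2^{|w_t|}`.
[cite: LimayeSrinivasanTavenas2025, Lemma 22] -/
theorem complexity_wordPoly_le_of_mergePrefix (d' : ℕ) :
    ∀ (j D : ℕ), D = d' + j → ∀ w : Fin D → Bool,
      (∀ t : Fin D, (t : ℕ) < d' → streamLen k w (w t) t ≤ streamLen k w (!w t) t) →
      (∀ t : Fin D, (t : ℕ) < d' → 1 ≤ letterSize k w t) →
      (∀ t : Fin D, d' ≤ (t : ℕ) →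
        streamLen k w (!w t) t ≤ streamLen k w (w t) t ∨ letterSize k w t = 0) →
      complexity (wordPoly k w K) ≤ 6 * ∑ t : Fin D, 2 ^ letterSize k w t := by
  intro j
  induction j with
  | zero =>
    intro D hD w hm hℓ _
    subst hD
    exact complexity_wordPoly_le_of_merge k w K (fun t => hm t (by omega)) (fun t => hℓ t (by omega))
  | succ j ih =>
    intro D hD w₀ hm₀ hℓ₀ htail₀
    subst hD
    -- restate with the successor outside, so that `Fin.last` / `Fin.castSucc` apply verbatim
    have key : ∀ w : Fin (d' + j + 1) → Bool,
        (∀ t : Fin (d' + j + 1), (t : ℕ) < d' → streamLen k w (w t) t ≤ streamLen k w (!w t) t) →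
        (∀ t : Fin (d' + j + 1), (t : ℕ) < d' → 1 ≤ letterSize k w t) →
        (∀ t : Fin (d' + j + 1), d' ≤ (t : ℕ) →
          streamLen k w (!w t) t ≤ streamLen k w (w t) t ∨ letterSize k w t = 0) →
        complexity (wordPoly k w K) ≤ 6 * ∑ t : Fin (d' + j + 1), 2 ^ letterSize k w t := by
      intro w hm hℓ htail
      have hlast := htail (Fin.last (d' + j)) (by simp)
      rw [Fin.val_last] at hlast
      refine (complexity_wordPoly_le_of_free k w K hlast).trans ?_
      have ih' := ih (d' + j) rfl (fun i : Fin (d' + j) => w (Fin.castSucc i))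
        (fun t ht => by
          have h := hm (Fin.castSucc t) (by simpa using ht)
          rw [Fin.val_castSucc] at h
          rwa [streamLen_castSucc k w _ t (by omega), streamLen_castSucc k w _ t (by omega)])
        (fun t ht => hℓ (Fin.castSucc t) (by simpa using ht))
        (fun t ht => by
          have h := htail (Fin.castSucc t) (by simpa using ht)
          rw [Fin.val_castSucc] at h
          rw [streamLen_castSucc k w _ t (by omega), streamLen_castSucc k w _ t (by omega)]
          exact h)
      rw [Fin.sum_univ_castSucc]
      have h1 := Nat.one_le_two_pow (n := letterSize k w (Fin.last (d' + j)))
      have h2 : ∑ i : Fin (d' + j), 2 ^ letterSize k (fun i : Fin (d' + j) => w (Fin.castSucc i)) i =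
          ∑ i : Fin (d' + j), 2 ^ letterSize k w (Fin.castSucc i) := rfl
      omega
    exact key w₀ hm₀ hℓ₀ htail₀

end Tail

end ProductDepthWallTwo

end Summit.ValiantsHypothesis.ValiantsHypothesis.Theorems.BarrierLeverDefinableEquations
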